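import Literature.AnabelianGeometry.AbsoluteAnabelian.LocalResidueMapRestrictionIndex
import Literature.NumberTheory.GaloisRepresentations.ArtinRestriction
import Literature.NumberTheory.GaloisRepresentations.LocalFieldFiniteExtension
import HarnessLib

/-!
# The residue map under restriction, III: the OPEN-SUBGROUP form
# `inv_{F̄^U} ∘ Res_U = [Γ_F : U] · inv_F` ([AbsTopIII] Rmk. 3.2.2 / Rmk. 1.10.1 (iii) as printed)

abc-iut cell, layer L4, sub-DAG `plan/L4/SUBDAG-AbsTopIII-Prop32.md` row **P32.i.L07-model**
(open-subgroup instance; seat abc-iut-w4-d045 g4).  S. Mochizuki, *Topics in Absolute Anabelian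
Geometry III* (2015), Prop. 3.2 (i) p. 71 l.15–17 («functorial … relative to `𝒞^MLF_T`, in the evident
sense») with Rmk. 3.2.2 p. 73 l.17–24 and Rmk. 1.10.1 (iii) p. 44: the isomorphisms
`H²(G, μ) ⥲ Ẑ` are compatible along OPEN SUBGROUPS `H ⊆ G` «relative to dividing … by a factor given
by the index of the image of the induced open homomorphism on arithmetic Galois groups».  The tree
proves the index formula for a finite extension `E/F` given as a Type with `[Algebra F E]`
(`Prop121vii.invLevel_resMu`, `Prop121vii.invariantQZEquiv_res`, abc-iut-w5-d201,
`LocalResidueMapRestrictionIndex.lean`; J.-P. Serre, *Corps locaux* XIII §3 Prop. 7).  This file is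
the form in which print states it: START from an open subgroup `U ≤ Γ_F = Gal(F̄/F)` of the absolute
Galois group of a `p`-adic local field `F`, take its fixed field `F̄^U ⊆ F̄` (a finite extension of
`F` of degree `[Γ_F : U]`, Krull correspondence — trunk `finrank_fixedField_of_isOpen`,
`fixingSubgroup_fixedField_of_isOpen`), and read the index as `U.index`:

* `Prop121vii.invLevel_resMu_fixedField` — level `n`:
  `inv_{F̄^U,n} (Res x) = [Γ_F : U] · inv_{F,n} x`;
* `Prop121vii.invariantQZEquiv_res_fixedField` — on `H²(·, μ_{ℚ/ℤ})`:
  `inv_{F̄^U} (Res x) = [Γ_F : U] • inv_F x`;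
* `Prop121vii.invariantQZEquiv_res_fixedField_std` — the same with the local-field structure of
  `F̄^U` SUPPLIED (the spectral-norm structure `FiniteExtension.valuativeRel/topologicalSpace/
  isNonarchimedeanLocalField` of the trunk), so that no instance is left to the consumer;
* `Prop121vii.range_absGaloisRestrict_fixedField_conj` / `index_range_absGaloisRestrict_fixedField` —
  the «image of the induced open homomorphism» `Γ_{F̄^U} → Γ_F` is a conjugate of `U` and has index
  `[Γ_F : U]` (trunk `exists_mem_range_absGaloisRestrict_fixedField_iff`).

The local-field structure on `F̄^U` enters the first two theorems as instance ARGUMENTS (any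
`[ValuativeRel] [TopologicalSpace] [IsNonarchimedeanLocalField]` structure on the field `F̄^U`; the
residue maps `invLevel` are THE invariant maps for that structure), exactly as in
`invariantQZEquiv_res`.  HONEST FRAMING: textbook local class field theory glued to Krull's Galois
correspondence, all inputs proved in the tree; 0 new definitions, 0 named facts; nothing here bears
on [IUTchIII] Cor. 3.12 or takes a side.

## References
* [MochizukiAbsTopIII2015] S. Mochizuki, *Topics in Absolute Anabelian Geometry III*, Prop. 3.2 (i)
  p. 71, Rmk. 3.2.2 p. 73, Rmk. 1.10.1 (iii) p. 44.
* [SerreLocalFields1979] J.-P. Serre, *Local Fields*, GTM 67, XIII §3 Prop. 7.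
* [NeukirchANT1999] J. Neukirch, *Algebraic Number Theory*, Ch. IV §1 (Krull topology).
-/

noncomputable section

universe u

namespace Literature.AnabelianGeometry.AbsoluteAnabelian

open Field IntermediateField
open Literature.NumberTheory.GaloisRepresentations

namespace Prop121vii

variable (F : Type u) [Field F] [ValuativeRel F] [TopologicalSpace F] [IsNonarchimedeanLocalField F]
  [CharZero F]


/-- **Rmk. 3.2.2 at level `n`, open-subgroup form**: for an open subgroup `U ≤ Γ_F` of the absolute
Galois group of a `p`-adic local field `F` (char. `0`), with fixed field `F̄^U` carrying ANY structure of
non-archimedean local field, THE residue maps satisfy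
`inv_{F̄^U,n} (Res_{F̄^U/F} x) = [Γ_F : U] · inv_{F,n} (x)` on `H²(Γ_F, μ_n)`.
[cite: MochizukiAbsTopIII2015, Remark 3.2.2 p.73] [cite: SerreLocalFields1979, XIII §3 Prop. 7] -/
theorem invLevel_resMu_fixedField (U : Subgroup (absoluteGaloisGroup F))
    (hU : IsOpen (U : Set (absoluteGaloisGroup F)))
    [ValuativeRel (fixedField U : IntermediateField F (AlgebraicClosure F))] [TopologicalSpace (fixedField U : IntermediateField F (AlgebraicClosure F))] [IsNonarchimedeanLocalField (fixedField U : IntermediateField F (AlgebraicClosure F))]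
    (n : ℕ) [NeZero n] (x : galoisCohomology (DiscreteGaloisModule.mu F n) 2) :
    invLevel (fixedField U : IntermediateField F (AlgebraicClosure F)) n (resMu F (fixedField U : IntermediateField F (AlgebraicClosure F)) n 2 x) = (U.index : ZMod n) * invLevel F n x := by
  haveI : FiniteDimensional F (fixedField U : IntermediateField F (AlgebraicClosure F)) := finiteDimensional_fixedField_of_isOpen U hU
  rw [invLevel_resMu, finrank_fixedField_of_isOpen U hU]

/-- **Rmk. 3.2.2 / Rmk. 1.10.1 (iii) on `H²(·, μ_{ℚ/ℤ})`, open-subgroup form**: for an open subgroup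
`U ≤ Γ_F` (`F` a `p`-adic local field, char. `0`), with fixed field `F̄^U` carrying any structure of
non-archimedean local field, `inv_{F̄^U} (Res x) = [Γ_F : U] • inv_F (x)` for THE residue isomorphisms
`invariantQZEquiv : H²(·, μ_{ℚ/ℤ}) ≃+ ℚ/ℤ` — «a compatibility relative to dividing … by a factor given
by the index of the image of the induced open homomorphism on arithmetic Galois groups».
[cite: MochizukiAbsTopIII2015, Remark 3.2.2 p.73] [cite: MochizukiAbsTopIII2015, Remark 1.10.1 (iii) p.44]
[cite: SerreLocalFields1979, XIII §3 Prop. 7] -/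
theorem invariantQZEquiv_res_fixedField (U : Subgroup (absoluteGaloisGroup F))
    (hU : IsOpen (U : Set (absoluteGaloisGroup F)))
    [ValuativeRel (fixedField U : IntermediateField F (AlgebraicClosure F))] [TopologicalSpace (fixedField U : IntermediateField F (AlgebraicClosure F))] [IsNonarchimedeanLocalField (fixedField U : IntermediateField F (AlgebraicClosure F))]
    (x : H2MuQZ F) :
    invariantQZEquiv (fixedField U : IntermediateField F (AlgebraicClosure F)) (H2MuQZ.res F (fixedField U : IntermediateField F (AlgebraicClosure F)) x) = U.index • invariantQZEquiv F x := by
  haveI : FiniteDimensional F (fixedField U : IntermediateField F (AlgebraicClosure F)) := finiteDimensional_fixedField_of_isOpen U hU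
  rw [invariantQZEquiv_res, finrank_fixedField_of_isOpen U hU]

/-- **The same with the local-field structure of `F̄^U` supplied** (the trunk's spectral-norm structure
`FiniteExtension.valuativeRel / topologicalSpace / isNonarchimedeanLocalField` on the finite extension
`F̄^U / F`): nothing is left to the consumer but the open subgroup.
[cite: MochizukiAbsTopIII2015, Remark 3.2.2 p.73] [cite: SerreLocalFields1979, II §2 Cor. 2] -/
theorem invariantQZEquiv_res_fixedField_std (U : Subgroup (absoluteGaloisGroup F))
    (hU : IsOpen (U : Set (absoluteGaloisGroup F))) (x : H2MuQZ F) :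
    haveI : FiniteDimensional F (fixedField U : IntermediateField F (AlgebraicClosure F)) := finiteDimensional_fixedField_of_isOpen U hU
    letI := FiniteExtension.valuativeRel F (fixedField U : IntermediateField F (AlgebraicClosure F))
    letI := FiniteExtension.topologicalSpace F (fixedField U : IntermediateField F (AlgebraicClosure F))
    haveI := FiniteExtension.isNonarchimedeanLocalField F (fixedField U : IntermediateField F (AlgebraicClosure F))
    invariantQZEquiv (fixedField U : IntermediateField F (AlgebraicClosure F)) (H2MuQZ.res F (fixedField U : IntermediateField F (AlgebraicClosure F)) x) = U.index • invariantQZEquiv F x := by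
  haveI : FiniteDimensional F (fixedField U : IntermediateField F (AlgebraicClosure F)) := finiteDimensional_fixedField_of_isOpen U hU
  letI := FiniteExtension.valuativeRel F (fixedField U : IntermediateField F (AlgebraicClosure F))
  letI := FiniteExtension.topologicalSpace F (fixedField U : IntermediateField F (AlgebraicClosure F))
  haveI := FiniteExtension.isNonarchimedeanLocalField F (fixedField U : IntermediateField F (AlgebraicClosure F))
  exact invariantQZEquiv_res_fixedField F U hU x

omit [ValuativeRel F] [TopologicalSpace F] [IsNonarchimedeanLocalField F] in
/-- **«The image of the induced open homomorphism on arithmetic Galois groups»**: for an open subgroup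
`U ≤ Γ_F` (char. `0`) the image of the restriction `Γ_{F̄^U} → Γ_F` (through the chosen `F`-embedding
`F̄ → (F̄^U)‾`, `absGaloisRestrict`) is a conjugate `g U g⁻¹` of `U`.
[cite: MochizukiAbsTopIII2015, Remark 3.2.2 p.73] [cite: NeukirchANT1999, Ch. IV §1] -/
theorem range_absGaloisRestrict_fixedField_conj (U : Subgroup (absoluteGaloisGroup F))
    (hU : IsOpen (U : Set (absoluteGaloisGroup F))) :
    ∃ g : absoluteGaloisGroup F,
      (absGaloisRestrict F (fixedField U : IntermediateField F (AlgebraicClosure F))).range = U.map (MulAut.conj g).toMonoidHom := by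
  obtain ⟨g, hg⟩ := exists_mem_range_absGaloisRestrict_fixedField_iff U hU
  refine ⟨g, Subgroup.ext fun γ => ?_⟩
  rw [hg γ, Subgroup.mem_map_equiv, MulAut.conj_symm_apply]

omit [ValuativeRel F] [TopologicalSpace F] [IsNonarchimedeanLocalField F] in
/-- **The index of the image is `[Γ_F : U]`**: `[Γ_F : res(Γ_{F̄^U})] = [Γ_F : U]` (conjugate subgroups
have the same index) — the «factor given by the index» of Rmk. 3.2.2 / Rmk. 1.10.1 (iii) read on the
image, equal to the degree `[F̄^U : F]`. [cite: MochizukiAbsTopIII2015, Remark 1.10.1 (iii) p.44]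
[cite: NeukirchANT1999, Ch. IV §1] -/
theorem index_range_absGaloisRestrict_fixedField (U : Subgroup (absoluteGaloisGroup F))
    (hU : IsOpen (U : Set (absoluteGaloisGroup F))) :
    (absGaloisRestrict F (fixedField U : IntermediateField F (AlgebraicClosure F))).range.index = U.index := by
  obtain ⟨g, hg⟩ := range_absGaloisRestrict_fixedField_conj F U hU
  rw [hg]
  exact Subgroup.index_map_equiv U (MulAut.conj g)

omit [ValuativeRel F] [TopologicalSpace F] [IsNonarchimedeanLocalField F] in
/-- The degree of the fixed field equals the index of the image of `Γ_{F̄^U} → Γ_F`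
(`[F̄^U : F] = [Γ_F : res(Γ_{F̄^U})]`), so the two readings of «the index» in Rmk. 3.2.2 agree.
[cite: MochizukiAbsTopIII2015, Remark 3.2.2 p.73] [cite: NeukirchANT1999, Ch. IV §1] -/
theorem finrank_fixedField_eq_index_range (U : Subgroup (absoluteGaloisGroup F))
    (hU : IsOpen (U : Set (absoluteGaloisGroup F))) :
    Module.finrank F (fixedField U : IntermediateField F (AlgebraicClosure F)) = (absGaloisRestrict F (fixedField U : IntermediateField F (AlgebraicClosure F))).range.index := by
  rw [index_range_absGaloisRestrict_fixedField F U hU, finrank_fixedField_of_isOpen U hU]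

end Prop121vii

end Literature.AnabelianGeometry.AbsoluteAnabelian

end
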